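import Summits.ResolutionOfSingularities.ResolutionOfSingularities.Theorems.MarkedTransferCampaignW24ReducedBridge
import Literature.RingTheory.MvPowerSeries.HasseDerivResidue
import HarnessLib

/-!
# The LEVEL-`q` bridge, part 1: `Ψ_q G = G(x^q)` and `Φ_{q,r} G = x^r·G(x^q)` (one variable, `q = 2^e`), their Hasse derivatives in
# characteristic 2, and the residue bookkeeping of a passenger (HIRONAKA-L · cell `res-hironaka` · slot W2.4 «bottom-member re-run», one-variable
# REDUCED MODEL at level `e ≥ 1`; generalises res-D-pv-020's `Ψ = Ψ_2`, `Φ = Φ_{2,1}` of `MarkedTransferCampaignW24ReducedBridge.lean`)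

**HONEST FRAMING.** OURS throughout: kernel theorems about OURS bookkeeping objects of the cell's one-variable reduced model
(`CampaignW24.ReducedBridge`, res-D-pv-020; `CampaignW24.ReducedRun`, res-D-pv-035). Nothing below is a statement of H. Hironaka's manuscript
[Hironaka2017] (lit key `paper:url-3343fd9e678b`), nothing asserts that any statement of it holds, nothing is a claim about resolution of
singularities in characteristic `p`; the manuscript stays «under review» (D-0012/D-0089). AI work, weaker than expert review. Written by
res-D-pv-020 (W2.4 lineage; own thread 2026-08-27T12:59Z «n = 1, every level e»).

## What is proved (`K` a field; `q ≠ 0`; `[CharP K 2]` and `q = 2^e` where marked)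
* §1 `psiQ q`, `phiQ q r` (REAL bookkeeping definitions); coefficients: `coeff_psiQ`, `coeff_phiQ_of_lt` (`r < q`: `Φ_{q,r} G` lives on the residue
  class `r mod q`, reading `G` at the quotient), `coeff_phiQ_add`; `psiQ_mul_phiQ`, `phiQ_sub`, `phiQ_eq_zero_iff`, `phiQ_zero_left`.
* §2 (char 2, `q = 2^e`, `A ≤ r < q`) Hasse derivatives by the Lucas split at `q` (tree `choose_add_pow_mul_add_pow_mul_modEq`):
  `hasseD_low_phiQ : ∂^{(A)}(Φ_{q,r} G) = C(r, A)·Φ_{q,r−A} G` and `hasseD_qmul_phiQ : ∂^{(q·c)}(Φ_{q,r} G) = Φ_{q,r}(D^{(c)} G)`.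
* §3 residues: `IsMultQ q w` (support on exponents `≡ 0 mod q`), `PairLT r r₀` (digit pair `(r % 2, r / 2)` lexicographically below that of
  `r₀`), `ResIn q good R` (every exponent of `R` has residue in `good`), closure (`ResIn.sub/.mul_left/.hasseD_qmul`) and
  `hasseD_top_eq_zero_of_resIn : ∂^{(r₀)}R = 0` when `good ⊆ PairLT · r₀` (such a residue never dominates `r₀` digitwise).
Consumers: the level-`q` step / run files (the `n = 1` slice of ⟨`Rescue.FiniteSupportStaysInBox_ours`⟩ at `p = 2` for every level `e`).
Hypotheses: each theorem's own binders; no FACT-LIST fact, no DEFECT binder. Standard axioms only.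
-/

noncomputable section

set_option linter.dupNamespace false -- mandated namespace of this single-conjunct summit

namespace Summit.ResolutionOfSingularities.ResolutionOfSingularities.Theorems

namespace CampaignW24

namespace ReducedBridge

open Literature.RingTheory.MvPowerSeries (hasseDeriv coeff_hasseDeriv choose_add_pow_mul_add_pow_mul_modEq)
open CampaignW21 (hasseD)

variable {K : Type} [Field K]

/-! ## §1 `Ψ_q` and `Φ_{q,r}` -/

/-- [OURS · W2.4 bridge] `Ψ_q G = G(x^q)` (`q ≠ 0`). Bookkeeping definition. [folklore] -/
def psiQ (q : ℕ) (hq : q ≠ 0) : PowerSeries K →ₐ[K] MvPowerSeries (Fin 1) K := (MvPowerSeries.expand q hq).comp iota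

/-- [OURS · W2.4 bridge] `Φ_{q,r} G = x^r·G(x^q)`. Bookkeeping definition. [folklore] -/
def phiQ (q : ℕ) (hq : q ≠ 0) (r : ℕ) (G : PowerSeries K) : MvPowerSeries (Fin 1) K :=
  MvPowerSeries.monomial (Finsupp.single 0 r) 1 * psiQ q hq G

variable {q : ℕ} (hq : q ≠ 0)

/-- `d = d % q + q·(d / q)` read as `d = r + q·(d / q)` from `d % q = r`. [folklore] -/
theorem eq_add_mul_div_of_mod_eq {d r : ℕ} (h : d % q = r) : d = r + q * (d / q) := by
  have := Nat.mod_add_div d q; omega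

/-- Coefficients of `Ψ_q G` at multiples of `q`. [folklore] -/
theorem coeff_psiQ_mul (G : PowerSeries K) (m : ℕ) :
    MvPowerSeries.coeff (Finsupp.single 0 (q * m)) (psiQ q hq G) = PowerSeries.coeff m G := by
  have h : (Finsupp.single (0 : Fin 1) (q * m)) = q • Finsupp.single 0 m := by rw [Finsupp.smul_single, smul_eq_mul]
  rw [psiQ, AlgHom.comp_apply, h, MvPowerSeries.coeff_expand_smul, coeff_iota]

/-- Coefficients of `Ψ_q G`: `coeff_d = [d ≡ 0 mod q]·coeff_{d/q} G`. [folklore] -/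
theorem coeff_psiQ (G : PowerSeries K) (d : Fin 1 →₀ ℕ) :
    MvPowerSeries.coeff d (psiQ q hq G) = if d 0 % q = 0 then PowerSeries.coeff (d 0 / q) G else 0 := by
  split_ifs with h
  · have hd : d 0 = q * (d 0 / q) := by have := eq_add_mul_div_of_mod_eq (q := q) h; omega
    rw [eq_single d, Finsupp.single_eq_same, hd, coeff_psiQ_mul, Nat.mul_div_cancel_left _ (Nat.pos_of_ne_zero hq)]
  · rw [psiQ, AlgHom.comp_apply]
    exact MvPowerSeries.coeff_expand_of_not_dvd q hq _ fun hdvd => h (Nat.mod_eq_zero_of_dvd hdvd)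

/-- Coefficients of `Φ_{q,r} G` for `r < q`: `coeff_d = [d ≡ r mod q]·coeff_{d/q} G`. [folklore] -/
theorem coeff_phiQ_of_lt {r : ℕ} (hr : r < q) (G : PowerSeries K) (d : Fin 1 →₀ ℕ) :
    MvPowerSeries.coeff d (phiQ q hq r G) = if d 0 % q = r then PowerSeries.coeff (d 0 / q) G else 0 := by
  rw [phiQ, MvPowerSeries.coeff_monomial_mul]
  by_cases hle : Finsupp.single (0 : Fin 1) r ≤ d
  · have hrd : r ≤ d 0 := by simpa using hle 0
    rw [if_pos hle, one_mul, coeff_psiQ]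
    simp only [Finsupp.tsub_apply, Finsupp.single_eq_same]
    by_cases h : d 0 % q = r
    · have hd := eq_add_mul_div_of_mod_eq (q := q) h
      rw [if_pos h, show d 0 - r = q * (d 0 / q) by omega, if_pos (Nat.mul_mod_right _ _),
        Nat.mul_div_cancel_left _ (Nat.pos_of_ne_zero hq)]
    · rw [if_neg h, if_neg]
      intro h0
      apply h
      have h1 := eq_add_mul_div_of_mod_eq (q := q) h0
      have h2 : d 0 = r + q * ((d 0 - r) / q) := by omega
      rw [h2, Nat.add_mul_mod_self_left, Nat.mod_eq_of_lt hr]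
  · have hrd : ¬ r ≤ d 0 := fun h => hle fun i => by
      have hi : i = 0 := Subsingleton.elim _ _
      subst hi; simpa using h
    rw [if_neg hle, if_neg]
    intro h
    exact hrd (by have := eq_add_mul_div_of_mod_eq (q := q) h; omega)

/-- Coefficients of `Φ_{q,r} G` on its residue class: `coeff_{r + q·m} = coeff_m G` (`r < q`). [folklore] -/
theorem coeff_phiQ_add {r : ℕ} (hr : r < q) (G : PowerSeries K) (m : ℕ) :
    MvPowerSeries.coeff (Finsupp.single 0 (r + q * m)) (phiQ q hq r G) = PowerSeries.coeff m G := by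
  rw [coeff_phiQ_of_lt hq hr, Finsupp.single_eq_same, if_pos (by rw [Nat.add_mul_mod_self_left, Nat.mod_eq_of_lt hr]),
    show (r + q * m) / q = m by rw [Nat.add_mul_div_left _ _ (Nat.pos_of_ne_zero hq), Nat.div_eq_of_lt hr, zero_add]]

/-- `Ψ_q a · Φ_{q,r} b = Φ_{q,r}(a·b)`. [folklore] -/
theorem psiQ_mul_phiQ (r : ℕ) (a b : PowerSeries K) : psiQ q hq a * phiQ q hq r b = phiQ q hq r (a * b) := by
  rw [phiQ, phiQ, map_mul]; ring

/-- `Φ_{q,r} (a − b) = Φ_{q,r} a − Φ_{q,r} b`. [folklore] -/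
theorem phiQ_sub (r : ℕ) (a b : PowerSeries K) : phiQ q hq r (a - b) = phiQ q hq r a - phiQ q hq r b := by
  rw [phiQ, phiQ, phiQ, map_sub, mul_sub]

/-- `Φ_{q,r} 0 = 0`. [folklore] -/
theorem phiQ_zero (r : ℕ) : phiQ q hq r (0 : PowerSeries K) = 0 := by rw [phiQ, map_zero, mul_zero]

/-- `Φ_{q,0} = Ψ_q`. [folklore] -/
theorem phiQ_zero_left (G : PowerSeries K) : phiQ q hq 0 G = psiQ q hq G := by
  rw [phiQ, Finsupp.single_zero, MvPowerSeries.monomial_zero_one, one_mul]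

/-- `Φ_{q,r} G = 0 ↔ G = 0` (`r < q`). [folklore] -/
theorem phiQ_eq_zero_iff {r : ℕ} (hr : r < q) (G : PowerSeries K) : phiQ q hq r G = 0 ↔ G = 0 := by
  refine ⟨fun h => ?_, fun h => by rw [h, phiQ_zero]⟩
  ext m
  rw [← coeff_phiQ_add hq hr G m, h, map_zero, map_zero]

/-! ## §2 Hasse derivatives of `Φ_{q,r} G` in characteristic 2 (`q = 2^e`) -/

section Hasse

variable [CharP K 2] {e : ℕ}

/-- Lucas split at `q = 2^e` in `K`: `C(r + q·c, A + q·c′) = C(r, A)·C(c, c′)` for `r, A < q`. [cite: Abad2019pBases, Lemma 6.2 (Lucas arithmetic; kernel bookkeeping)] -/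
theorem natCast_choose_add_pow_mul {r A : ℕ} (c c' : ℕ) (hr : r < 2 ^ e) (hA : A < 2 ^ e) :
    (((r + 2 ^ e * c).choose (A + 2 ^ e * c') : ℕ) : K) = ((r.choose A * c.choose c' : ℕ) : K) := by
  haveI : Fact (Nat.Prime 2) := ⟨Nat.prime_two⟩
  exact (CharP.natCast_eq_natCast K 2).mpr (choose_add_pow_mul_add_pow_mul_modEq e c c' hr hA)

/-- **`∂^{(A)}(Φ_{q,r} G) = C(r, A)·Φ_{q,r−A} G`** for `A ≤ r < q = 2^e`. [cite: Abad2019pBases, Lemma 6.2 (Lucas arithmetic; kernel bookkeeping)] -/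
theorem hasseD_low_phiQ {r A : ℕ} (hr : r < 2 ^ e) (hAr : A ≤ r) (G : PowerSeries K) :
    hasseD K 1 (Finsupp.single 0 A) (phiQ (2 ^ e) (pow_ne_zero e two_ne_zero) r G) =
      ((r.choose A : ℕ) : K) • phiQ (2 ^ e) (pow_ne_zero e two_ne_zero) (r - A) G := by
  have hq : (2 ^ e : ℕ) ≠ 0 := pow_ne_zero e two_ne_zero
  have hqpos : 0 < 2 ^ e := pow_pos two_pos e
  have hrA : r - A < 2 ^ e := by omega
  ext d
  show MvPowerSeries.coeff d (hasseDeriv (Finsupp.single 0 A) (phiQ (2 ^ e) hq r G)) = _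
  rw [coeff_hasseDeriv, prod_choose_fin_one, Finsupp.single_eq_same, map_smul, coeff_phiQ_of_lt hq hr, coeff_phiQ_of_lt hq hrA,
    smul_eq_mul]
  simp only [Finsupp.add_apply, Finsupp.single_eq_same]
  by_cases h : d 0 % 2 ^ e = r - A
  · have hd := eq_add_mul_div_of_mod_eq (q := 2 ^ e) h
    have h1 : (A + d 0) % 2 ^ e = r := by
      rw [hd, show A + (r - A + 2 ^ e * (d 0 / 2 ^ e)) = r + 2 ^ e * (d 0 / 2 ^ e) by omega, Nat.add_mul_mod_self_left,
        Nat.mod_eq_of_lt hr]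
    have h2 : (A + d 0) / 2 ^ e = d 0 / 2 ^ e := by
      conv_lhs => rw [hd, show A + (r - A + 2 ^ e * (d 0 / 2 ^ e)) = r + 2 ^ e * (d 0 / 2 ^ e) by omega]
      rw [Nat.add_mul_div_left _ _ hqpos, Nat.div_eq_of_lt hr, zero_add]
    rw [if_pos h1, if_pos h, h2]
    have h3 : A + d 0 = r + 2 ^ e * (d 0 / 2 ^ e) := by omega
    rw [h3, show A = A + 2 ^ e * 0 by ring]
    rw [show r + 2 ^ e * (d 0 / 2 ^ e) = r + 2 ^ e * (d 0 / 2 ^ e) from rfl,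
      natCast_choose_add_pow_mul (d 0 / 2 ^ e) 0 hr (by omega), Nat.choose_zero_right, mul_one]
    simp
  · rw [if_neg h, mul_zero]
    split_ifs with h'
    · exfalso
      apply h
      have hd := eq_add_mul_div_of_mod_eq (q := 2 ^ e) h'
      have h2 : d 0 = (r - A) + 2 ^ e * ((A + d 0) / 2 ^ e) := by omega
      rw [h2, Nat.add_mul_mod_self_left, Nat.mod_eq_of_lt hrA]
    · rw [mul_zero]

/-- **`∂^{(q·c)}(Φ_{q,r} G) = Φ_{q,r}(D^{(c)} G)`** for `r < q = 2^e`. [cite: Abad2019pBases, Lemma 6.2 (Lucas arithmetic; kernel bookkeeping)] -/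
theorem hasseD_qmul_phiQ {r : ℕ} (hr : r < 2 ^ e) (c : ℕ) (G : PowerSeries K) :
    hasseD K 1 (Finsupp.single 0 (2 ^ e * c)) (phiQ (2 ^ e) (pow_ne_zero e two_ne_zero) r G) =
      phiQ (2 ^ e) (pow_ne_zero e two_ne_zero) r (ReducedRun.D c G) := by
  have hq : (2 ^ e : ℕ) ≠ 0 := pow_ne_zero e two_ne_zero
  have hqpos : 0 < 2 ^ e := pow_pos two_pos e
  ext d
  show MvPowerSeries.coeff d (hasseDeriv (Finsupp.single 0 (2 ^ e * c)) (phiQ (2 ^ e) hq r G)) = _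
  rw [coeff_hasseDeriv, prod_choose_fin_one, Finsupp.single_eq_same, coeff_phiQ_of_lt hq hr, coeff_phiQ_of_lt hq hr]
  simp only [Finsupp.add_apply, Finsupp.single_eq_same]
  have hmod : (2 ^ e * c + d 0) % 2 ^ e = d 0 % 2 ^ e := by rw [add_comm, Nat.add_mul_mod_self_left]
  rw [hmod]
  by_cases h : d 0 % 2 ^ e = r
  · have hd := eq_add_mul_div_of_mod_eq (q := 2 ^ e) h
    have h2 : (2 ^ e * c + d 0) / 2 ^ e = c + d 0 / 2 ^ e := by
      conv_lhs => rw [hd, show 2 ^ e * c + (r + 2 ^ e * (d 0 / 2 ^ e)) = r + 2 ^ e * (c + d 0 / 2 ^ e) by ring]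
      rw [Nat.add_mul_div_left _ _ hqpos, Nat.div_eq_of_lt hr, zero_add]
    rw [if_pos h, if_pos h, h2, ReducedRun.coeff_D, add_comm (d 0 / 2 ^ e) c]
    have h3 : 2 ^ e * c + d 0 = r + 2 ^ e * (c + d 0 / 2 ^ e) := by
      conv_lhs => rw [hd]
      ring
    rw [h3, show 2 ^ e * c = 0 + 2 ^ e * c by ring, natCast_choose_add_pow_mul (c + d 0 / 2 ^ e) c hr hqpos, Nat.choose_zero_right,
      one_mul]
  · rw [if_neg h, if_neg h, mul_zero]

end Hasse

/-! ## §3 Residue bookkeeping: multiples of `q`, and passengers with prescribed residues -/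

/-- [OURS · W2.4 bridge] `w` is supported on exponents `≡ 0 (mod q)`. [folklore] -/
def IsMultQ (q : ℕ) (w : MvPowerSeries (Fin 1) K) : Prop := ∀ d : Fin 1 →₀ ℕ, d 0 % q ≠ 0 → MvPowerSeries.coeff d w = 0

/-- The digit pair of a residue `r < 2^e` read lexicographically with the FIRST digit `r % 2` dominant: `r` is below `r₀`. [folklore] -/
def PairLT (r r₀ : ℕ) : Prop := r % 2 < r₀ % 2 ∨ (r % 2 = r₀ % 2 ∧ r / 2 < r₀ / 2)

/-- [OURS · W2.4 bridge] a PASSENGER with residues in `good`: every exponent `d` of `R` has `good (d mod q)`. [folklore] -/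
def ResIn (q : ℕ) (good : ℕ → Prop) (R : MvPowerSeries (Fin 1) K) : Prop :=
  ∀ d : Fin 1 →₀ ℕ, MvPowerSeries.coeff d R ≠ 0 → good (d 0 % q)

omit [Field K] in
/-- `PairLT` is irreflexive. [folklore] -/
theorem PairLT.ne {r r₀ : ℕ} (h : PairLT r r₀) : r ≠ r₀ := by
  rintro rfl; rcases h with h | ⟨-, h⟩ <;> omega

/-- `Ψ_q u` is supported on multiples of `q`. [folklore] -/
theorem isMultQ_psiQ (u : PowerSeries K) : IsMultQ q (psiQ q hq u) := fun d hd => by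
  rw [coeff_psiQ, if_neg hd]

/-- `0` is a passenger for every residue predicate. [folklore] -/
theorem resIn_zero (good : ℕ → Prop) : ResIn q good (0 : MvPowerSeries (Fin 1) K) := fun _ hd => absurd (map_zero _) hd

/-- Passengers are closed under subtraction. [folklore] -/
theorem ResIn.sub {good : ℕ → Prop} {R R' : MvPowerSeries (Fin 1) K} (h : ResIn q good R) (h' : ResIn q good R') :
    ResIn q good (R - R') := fun d hd => by
  rw [map_sub] at hd
  by_cases h1 : MvPowerSeries.coeff d R = 0
  · rw [h1, zero_sub, neg_ne_zero] at hd; exact h' d hd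
  · exact h d h1

/-- Multiplying a passenger by a series in `x^q` keeps its residues. [folklore] -/
theorem ResIn.mul_left {good : ℕ → Prop} {w R : MvPowerSeries (Fin 1) K} (hw : IsMultQ q w) (h : ResIn q good R) :
    ResIn q good (w * R) := fun d hd => by
  classical
  rw [MvPowerSeries.coeff_mul] at hd
  obtain ⟨⟨i, j⟩, hij, hne⟩ := Finset.exists_ne_zero_of_sum_ne_zero hd
  rw [Finset.HasAntidiagonal.mem_antidiagonal] at hij
  have hi : MvPowerSeries.coeff i w ≠ 0 := fun h0 => hne (by rw [h0, zero_mul])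
  have hj : MvPowerSeries.coeff j R ≠ 0 := fun h0 => hne (by rw [h0, mul_zero])
  have hi0 : i 0 % q = 0 := by by_contra hc; exact hi (hw i hc)
  have hd0 : d 0 % q = j 0 % q := by
    rw [← hij, Finsupp.add_apply, Nat.add_mod, hi0, zero_add, Nat.mod_mod]
  rw [hd0]; exact h j hj

/-- Off its residues a passenger vanishes (contrapositive reading). [folklore] -/
theorem ResIn.coeff_eq_zero {good : ℕ → Prop} {R : MvPowerSeries (Fin 1) K} (h : ResIn q good R) {d : Fin 1 →₀ ℕ}
    (hd : ¬ good (d 0 % q)) : MvPowerSeries.coeff d R = 0 := by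
  by_contra hne; exact hd (h d hne)

section HasseRes

variable {e : ℕ}

/-- `∂^{(q·c)}` keeps residues (it lowers exponents by a multiple of `q`). [folklore] -/
theorem ResIn.hasseD_qmul {good : ℕ → Prop} {R : MvPowerSeries (Fin 1) K} (h : ResIn (2 ^ e) good R) (c : ℕ) :
    ResIn (2 ^ e) good (hasseD K 1 (Finsupp.single 0 (2 ^ e * c)) R) := fun d hd => by
  change MvPowerSeries.coeff d (hasseDeriv (Finsupp.single 0 (2 ^ e * c)) R) ≠ 0 at hd
  rw [coeff_hasseDeriv] at hd
  have hR : MvPowerSeries.coeff (Finsupp.single 0 (2 ^ e * c) + d) R ≠ 0 := fun h0 => hd (by rw [h0, mul_zero])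
  have := h _ hR
  rwa [Finsupp.add_apply, Finsupp.single_eq_same, add_comm, Nat.add_mul_mod_self_left] at this

variable [CharP K 2]

/-- **A passenger BELOW `r₀` is invisible to `∂^{(r₀)}`** (`r₀ < q = 2^e`): `∂^{(r₀)} R = 0` — a residue whose digit pair is below that of `r₀`
never dominates `r₀` digitwise (Lucas at `q`, then at `2`). [cite: Abad2019pBases, Lemma 6.2 (Lucas arithmetic; kernel bookkeeping)] -/
theorem hasseD_top_eq_zero_of_resIn {r₀ : ℕ} (hr₀ : r₀ < 2 ^ e) {good : ℕ → Prop} (hgood : ∀ ρ, good ρ → PairLT ρ r₀)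
    {R : MvPowerSeries (Fin 1) K} (h : ResIn (2 ^ e) good R) : hasseD K 1 (Finsupp.single 0 r₀) R = 0 := by
  haveI : Fact (Nat.Prime 2) := ⟨Nat.prime_two⟩
  ext d
  rw [MvPowerSeries.coeff_zero]
  show MvPowerSeries.coeff d (hasseDeriv (Finsupp.single 0 r₀) R) = 0
  rw [coeff_hasseDeriv, prod_choose_fin_one, Finsupp.single_eq_same]
  by_cases hR : MvPowerSeries.coeff (Finsupp.single 0 r₀ + d) R = 0
  · rw [hR, mul_zero]
  · have hlt := hgood _ (h _ hR)
    rw [Finsupp.add_apply, Finsupp.single_eq_same] at hlt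
    set m := r₀ + d 0 with hm
    have hsplit : ((m.choose r₀ : ℕ) : K) = (((m % 2 ^ e).choose r₀ * (m / 2 ^ e).choose 0 : ℕ) : K) := by
      have := natCast_choose_add_pow_mul (K := K) (e := e) (r := m % 2 ^ e) (A := r₀) (m / 2 ^ e) 0
        (Nat.mod_lt _ (pow_pos two_pos e)) hr₀
      rwa [Nat.mod_add_div, mul_zero, add_zero] at this
    rw [hsplit, Nat.choose_zero_right, mul_one]
    set r := m % 2 ^ e with hr
    have h2 : ((r.choose r₀ : ℕ) : K) = (((r % 2).choose (r₀ % 2) * (r / 2).choose (r₀ / 2) : ℕ) : K) :=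
      (CharP.natCast_eq_natCast K 2).mpr (@Choose.choose_modEq_choose_mod_mul_choose_div_nat r r₀ 2 _)
    rw [h2]
    rcases hlt with hlt | ⟨-, hlt⟩
    · rw [Nat.choose_eq_zero_of_lt hlt, zero_mul, Nat.cast_zero, zero_mul]
    · rw [Nat.choose_eq_zero_of_lt hlt, mul_zero, Nat.cast_zero, zero_mul]

end HasseRes

end ReducedBridge

end CampaignW24

end Summit.ResolutionOfSingularities.ResolutionOfSingularities.Theorems

end
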